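import Summits.AtomisticToContinuum.BoseEinsteinCondensation.Theorems.BECGroundStateSOSPeriodicIRBoundTwoSectorKLSTZero
import Summits.AtomisticToContinuum.BoseEinsteinCondensation.Theorems.BECGroundStateSOSPeriodicIRBoundTwoSectorWindowTLow
import Summits.AtomisticToContinuum.BoseEinsteinCondensation.Theorems.BECGroundStateSOSPeriodicIRBoundTwoSectorSectorGaps
import Summits.AtomisticToContinuum.BoseEinsteinCondensation.Theorems.BECGroundStateSOSPeriodicIRBoundTwoSectorLinearFloorArrow
import Summits.AtomisticToContinuum.BoseEinsteinCondensation.Theorems.BECGroundStateSOSPeriodicIRBoundLatticeSectorEnergyFinite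
import Summits.AtomisticToContinuum.BoseEinsteinCondensation.Theorems.BECGroundStateSOSPeriodicIRBoundTwoSectorAeZeroFloating
import HarnessLib

/-!
# Route `BECGroundStateSOS`, crux `PeriodicIRBound` (stmt-AtomisticToContinuum-3972), line `two-sector-gd-transfer` (v10) —
# standing reductions through the v9 pooled load S1₀ `FloatingTwoChannelLow`

Supports (does not close) stmt-AtomisticToContinuum-3972. Lead seat c23. With the six provable v9 stubs landed — S4₀
`stub_klsNearMinimiserTZero` (p160279), S5₀ `stub_windowAssemblyTLow` (p160319), S9a `stub_channelsOfSectorGaps` (p160384),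
S9b `stub_linearFloorGivesFloatingLowOf` (p160612), S9c `stub_latticeSectorEnergyFinite` (p160421), S9'
`stub_aeZeroFloatingLow` (p160400) — the registered skeleton `Cruxes/PeriodicIRBound/Lines/two_sector_gd_transfer.lean` (v10)
has exactly two `sorry`s, S1₀ `FloatingTwoChannelLow` (pooled, open-problem strength) and S6 `NonIntegrableHalf` (scope), and
its sorry-free composition is recorded here as importable theorems (registered by-products of the crux ledger):

* `stub_integrableHalfOfFloatingLowAlone` — S1₀ ALONE gives the crux's infrared inequality `IRBoundFor v` for every
  integrable admissible `v` (S4₀, S5₀ discharged; normal form p156444 inside);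
* `stub_periodicIRBoundOfFloatingLow` — S1₀ ∧ S6 ⇒ `PeriodicIRBound` by name (the fifth standing reduction of the crux, next to
  `stub_periodicIRBoundOfPooled` p139109, `stub_periodicIRBoundOfFloating` p155164, `LinearPhFloorWagner.stub_reduction`,
  `FsumPhasePencil`'s);
* `stub_floatingLowOfLinearParticleHoleFloor` — line 1's residual `C⁺ = LinearParticleHoleFloor` ⇒ S1₀ (S9a/S9b/S9c/S9'
  discharged): together with `floatingTwoChannelLow_of_floatingTwoChannel` (S1' ⇒ S1₀) and `floatingTwoChannelLow_of_pooled`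
  (stmt-12620 ∧ stmt-9094 ⇒ S1₀) of the Defs module, S1₀ is the kernel-checked funnel of every registered line's residual on
  the integrable half.

S1₀ reads: for every integrable admissible `v` and every window constant `K > 0` there are `ρ₀, C > 0`, `A ≥ 0` such that
for every `ε > 0` and `ρ < ρ₀`, eventually in `N`, every mode `0 < 2π‖n‖_∞/L_N ≤ K√ρ` admits a common floating chemical
potential `μ₊ ≥ −Aρ`, `μ₋ ≤ μ₊ + ε√(ρa)/L_N` with the two Kennedy–Lieb–Shastry channel inequalities (bound `CL_N²/‖n‖²_∞`,
thresholds `E₀(N) + μ₊` / `E₀(N) − μ₋`) on the exact-momentum test vectors `a†(φ_n)Ψ`, `a(φ_n)Ψ` of the momentum-zero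
near-minimisers `Ψ`. Nothing is cited as a fact; every input is a landed theorem of the line.
-/

noncomputable section

open scoped BigOperators ENNReal
open Filter MeasureTheory

namespace Summit.AtomisticToContinuum.BoseEinsteinCondensation.Cruxes.PeriodicIRBound.TwoSectorGdTransfer

open Literature.MathematicalPhysics.QuantumManyBody.BoseGas
open Summit.AtomisticToContinuum.BoseEinsteinCondensation.Theses.BECGroundStateSOS (PeriodicIRBound)
open Summit.AtomisticToContinuum.BoseEinsteinCondensation.Theorems.PeriodicIRBound.Negative (IRBoundFor)
open Summit.AtomisticToContinuum.BoseEinsteinCondensation.Cruxes.PeriodicIRBound.LinearPhFloorWagner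
  (LinearParticleHoleFloor)

/-! ### Per potential -/

/-- **The low floating bound alone gives the crux for `v`**: for an integrable admissible `v`, data
`∀ K > 0, ∃ ρ₀ C > 0, ∃ A ≥ 0, FloatingForLow v K ρ₀ C A` give `IRBoundFor v` (landed S4₀, S5₀, normal form p156444). [folklore] -/
theorem irBoundFor_of_floatingLow {v : ℝ → ℝ≥0∞} (hv : IsRepulsiveFiniteRange v) (hint : (∫⁻ x : Space, v ‖x‖) ≠ ⊤)
    (hF : ∀ K : ℝ, 0 < K → ∃ ρ₀ : ℝ, 0 < ρ₀ ∧ ∃ C : ℝ, 0 < C ∧ ∃ A : ℝ, 0 ≤ A ∧ FloatingForLow v K ρ₀ C A) :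
    IRBoundFor v :=
  irBoundFor_of_irBoundForZero hv hint
    (irBoundForZero_of_floatingLow hv hint hF (stub_klsNearMinimiserTZero v hv hint) stub_windowAssemblyTLow)

/-! ### Global (registered by-products of the crux ledger) -/

/-- **Registered by-product `stub_integrableHalfOfFloatingLowAlone`**: S1₀ `FloatingTwoChannelLow` alone gives `IRBoundFor v`
for every INTEGRABLE admissible `v`. [folklore] -/
theorem stub_integrableHalfOfFloatingLowAlone :
    FloatingTwoChannelLow → ∀ v : ℝ → ℝ≥0∞, IsRepulsiveFiniteRange v → (∫⁻ x : Space, v ‖x‖) ≠ ⊤ → IRBoundFor v :=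
  fun h1 => integrableHalf_of_floatingLow h1 stub_klsNearMinimiserTZero stub_windowAssemblyTLow

/-- **Registered by-product `stub_periodicIRBoundOfFloatingLow`** — the fifth standing reduction of the crux: S1₀
`FloatingTwoChannelLow` and the scope half S6 `NonIntegrableHalf` give `PeriodicIRBound` by name. [folklore] -/
theorem stub_periodicIRBoundOfFloatingLow : FloatingTwoChannelLow → NonIntegrableHalf → PeriodicIRBound :=
  fun h1 h6 => periodicIRBound_of_floatingLow h1 stub_klsNearMinimiserTZero stub_windowAssemblyTLow h6

/-- **Registered by-product `stub_floatingLowOfLinearParticleHoleFloor`**: line 1's pooled target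
`C⁺ = LinearParticleHoleFloor` implies S1₀ `FloatingTwoChannelLow` (landed S9c, S9a, S9b for `∫v ≠ 0`, S9' for `∫v = 0`). [folklore] -/
theorem stub_floatingLowOfLinearParticleHoleFloor : LinearParticleHoleFloor → FloatingTwoChannelLow :=
  fun hC => floatingTwoChannelLow_of_linearFloor
    (linearFloorGivesFloatingLow_of stub_latticeSectorEnergyFinite stub_channelsOfSectorGaps
      stub_linearFloorGivesFloatingLowOf) stub_aeZeroFloatingLow hC

/-- **Corollary**: `C⁺` and the scope half give the crux by name, through S1₀ (a second proof of
`ReductionIntegrable`'s `periodicIRBound_of_linearParticleHoleFloor`-type statement, now factored through the v9 load). [folklore] -/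
theorem periodicIRBound_of_linearParticleHoleFloor_via_floatingLow (hC : LinearParticleHoleFloor)
    (h6 : NonIntegrableHalf) : PeriodicIRBound :=
  stub_periodicIRBoundOfFloatingLow (stub_floatingLowOfLinearParticleHoleFloor hC) h6

end Summit.AtomisticToContinuum.BoseEinsteinCondensation.Cruxes.PeriodicIRBound.TwoSectorGdTransfer

end
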